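import Literature.Probability.RandomPlanarGeometry.CrossingTraversal
import Literature.Probability.RandomPlanarGeometry.ChordalKSCondition
import Literature.Probability.RandomPlanarGeometry.ChordalCurveFamilyProofs
import HarnessLib

/-!
# Kemppainen–Smirnov's rectangle-exit bound (Ann. Probab. 45 (2017), Prop. 3.7)

Topic `Literature/Probability/RandomPlanarGeometry` (family `crit-ising`); theorems only, no
definition and no named fact. Written in support of the named fact
`Literature.Probability.LatticeModels.exists_cylinderObservableIdentity_fkInterface`
(`LatticeModels/FKIsingNaturalMartingale.lean`), whose hypothesis (J3) — uniform sub-exponential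
tails of the running maxima of the discrete driving processes, Chelkak–Duminil-Copin–Hongler–
Kemppainen–Smirnov, C. R. Math. 352 (2014), Thm. 3: "`sup_δ E[exp(ε|W^δ_t|/√t)] < ∞`" — is, in
the printed proof, A. Kemppainen, S. Smirnov, *Random curves, scaling limits and Loewner
evolutions*, Ann. Probab. 45 (2017) 698–779 (arXiv:1212.6215v3), §3.3: Proposition 3.7 (the
present file) followed by Proposition 3.8 (1) and two Loewner estimates (App. A.3, Lemmas 5.11,
5.12 of the arXiv text).

**Proposition 3.7** (arXiv text, p. 16). "If Condition G2 holds, then there are constants `K > 0`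
and `c > 0` so that `P(Re[(Φγ)(τ_{R_{L,u}})] = ±L) ≤ K e^{-c L/u}` for any `0 < u < L`", where
`R_{L,u} = [-L, L] × [0, u]` and `τ_{R_{L,u}}` is the exit time of the rectangle. PROOF (verbatim
structure): "By symmetry, it is enough to consider the event `E` that `Φγ` exits the rectangle
`R_{L,u}` from the right-hand side `{L} × [0, u]`. Let `n = ⌊L/(Cu)⌋`. Consider the lines
`J_k = {Cu·k} × [0, u]`, `k = 1, 2, …, n`. On the event `E`, each of the lines `J_k` are hit
before `τ_{R_{L,u}}` and the hitting times are ordered `0 < τ_{J_1} < ⋯ < τ_{J_n} ≤ τ_{R_{L,u}}`.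
Let `x_k = Cu·k`. Now especially on the event `E` the annulus `A(x_1, u, Cu)` is crossed and
after each `τ_{J_k}` the annulus `A(x_{k+1}, u, Cu)` is crossed. Hence Condition G2 can be applied
with the stopping times `0, τ_{J_1}, …, τ_{J_{n-1}}` and the annuli `A(x_1,u,Cu), …, A(x_n,u,Cu)`.
This gives the upper bound `2^{-n}` for the probability of `E`."

## What is proved, and in which vocabulary

Laws of random curves are measures `μ` on `CurveClass ℂ` (curves modulo reparametrisation), pasts
and futures at the first hitting time `τ_F` of a closed set `F` are `CurveClass.stopAt F`,
`CurveClass.startFrom F` (`ChordalCurveFamily.lean`), crossings of annuli are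
`CurveClass.crossingIn` (`CrossingCondition.lean`) — the vocabulary of the tree's `ConditionG2`.

* HYPOTHESIS (the instances of Condition G2 in `ℍ` that the printed proof uses, in the integrated
  conditional form of `ConditionG2`): for every nonempty closed `F`, every centre `z₀ ∈ ℝ`, and
  every measurable set `S` of pasts WHOSE TRACES AVOID THE OPEN OUTER DISC `B(z₀, Cu)`,
  `μ({stopAt F ∈ S} ∩ {startFrom F crosses A(z₀, u, Cu)}) ≤ ½ · μ{stopAt F ∈ S}`.
  For such pasts `A(z₀, u, Cu) ∩ (ℍ ∖ γ[0, τ]) = A(z₀, u, Cu) ∩ ℍ` (the past does not meet the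
  open annulus), and in the printed proof the crossings of these annuli after `τ_{J_k}` are the
  unforced crossings (KS Def. 2.3) to which Condition G2 is applied. (The tree's
  `unforcedPart U b` takes a finite target `b : ℂ`, so `(ℍ; 0, ∞)` is not literally a
  `MarkedLaw`; the hypothesis is therefore stated directly in this configuration, and deriving
  it from a half-plane form of G2 is left to the consumer together with the support hypotheses
  — simple curves in `ℍ` from `0` — under which the two agree.)
* CONCLUSION (`measure_reach_halfPlane_le`, one side; `measure_reach_abs_re_le`, both sides):
  for a threshold `x₀`, `μ{curves starting in {sgn·re < x₀} which reach the half-plane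
  {sgn·re ≥ x₀ + n·Cu} while their initial segment up to that hitting time stays in the strip
  {|im| ≤ u}} ≤ 2^{-n} · μ(univ)` (`sgn = ±1`), hence `≤ 2 · 2^{-n} · μ(univ)` for
  `{|re| ≥ x₀ + n·Cu}`. With `x₀ ↓ 0`, `n = ⌊L/(Cu)⌋` this is the printed `2^{-n}` (the printed
  `K e^{-cL/u}` absorbs the rounding); the event "exit through a vertical side of `R_{L,u}`" is
  contained in ours (a curve in `ℍ̄` exiting `R_{L,u}` through `{±L} × [0, u]` has reached
  `{|re| ≥ L}` with its initial segment inside the closed rectangle). The starting abscissa is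
  relaxed from `0` to `sgn·re < x₀` because the discrete curves `Φ(φ^δ(γ^δ))` of CDHKS start near,
  not at, `0`.
* The deterministic core is KS's sentence "after each `τ_{J_k}` the annulus `A(x_{k+1}, u, Cu)`
  is crossed": `Curve.makesCrossing_startFrom_halfPlane` (the future from the first hitting of
  `{sgn·re ≥ x}` starts on that line, at distance `≥ Cu` from `x_{k+1} = sgn(x + Cu)`, and passes
  through the first hitting point of `{sgn·re ≥ x + Cu}`, at distance `≤ u` from it when the
  initial segment lies in the strip; one Aizenman–Burchard traversal contains a KS crossing,
  `Curve.HasTraversals.makesCrossing`), together with `Curve.range_stopAt_halfPlane_subset`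
  (the past lies in `{sgn·re ≤ x}`, hence avoids `B(x_{k+1}, Cu)`).

## References

* A. Kemppainen, S. Smirnov, Ann. Probab. 45 (2017) 698–779, §3.3, Prop. 3.7 and its proof
  (arXiv:1212.6215v3, p. 16); Def. 1.1, Def. 2.3, Condition G2 (§2.1.3). [KemppainenSmirnov2017]
* D. Chelkak, H. Duminil-Copin, C. Hongler, A. Kemppainen, S. Smirnov, C. R. Math. Acad. Sci.
  Paris 352 (2014) 157–161, Thm. 3. [CDHKSCRAS2014]
-/

noncomputable section

open Set MeasureTheory Metric Filter Topology
open scoped unitInterval ENNReal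

namespace Literature.Probability.RandomPlanarGeometry

/-! ### Elementary geometry of the lines `sgn·re = x` and the boundary annuli -/

section Geometry

variable {sgn : ℝ}

/-- A point on the far side of the line `sgn·re = x` (that is, `sgn·re z ≤ x`) is at distance at
least `R` from the real centre `sgn(x + R)`. [folklore] -/
theorem le_dist_ofReal_of_mul_re_le (hsgn : sgn = 1 ∨ sgn = -1) {x R : ℝ} {z : ℂ} (hz : sgn * z.re ≤ x)
    (hR : 0 ≤ R) : R ≤ dist z ((sgn * (x + R) : ℝ) : ℂ) := by
  rw [Complex.dist_eq]
  refine le_trans ?_ (Complex.abs_re_le_norm _)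
  rw [Complex.sub_re, Complex.ofReal_re]
  rcases hsgn with rfl | rfl
  · rw [one_mul] at hz
    rw [one_mul, abs_sub_comm, abs_of_nonneg (by linarith)]
    linarith
  · rw [neg_one_mul] at hz
    rw [neg_one_mul, abs_of_nonneg (by linarith)]
    linarith

/-- A point on the line `sgn·re = x + R` with `|im| ≤ u` is within distance `u` of the real centre
`sgn(x + R)`. [folklore] -/
theorem dist_ofReal_le_of_mul_re_eq {x R u : ℝ} {z : ℂ} (hsgn : sgn = 1 ∨ sgn = -1)
    (hz : sgn * z.re = x + R) (hu : |z.im| ≤ u) : dist z ((sgn * (x + R) : ℝ) : ℂ) ≤ u := by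
  rw [Complex.dist_eq]
  have hre : (z - ((sgn * (x + R) : ℝ) : ℂ)).re = 0 := by
    rw [Complex.sub_re, Complex.ofReal_re, ← hz]
    rcases hsgn with rfl | rfl <;> ring
  have him : (z - ((sgn * (x + R) : ℝ) : ℂ)).im = z.im := by
    rw [Complex.sub_im, Complex.ofReal_im, sub_zero]
  calc ‖z - ((sgn * (x + R) : ℝ) : ℂ)‖
      ≤ |(z - ((sgn * (x + R) : ℝ) : ℂ)).re| + |(z - ((sgn * (x + R) : ℝ) : ℂ)).im| :=
        Complex.norm_le_abs_re_add_abs_im _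
    _ = |z.im| := by rw [hre, him, abs_zero, zero_add]
    _ ≤ u := hu

/-- The half-plane `{sgn·re ≥ x}` is closed. [folklore] -/
theorem isClosed_setOf_le_mul_re (sgn x : ℝ) : IsClosed {z : ℂ | x ≤ sgn * z.re} :=
  isClosed_le continuous_const (continuous_const.mul Complex.continuous_re)

/-- The half-plane `{sgn·re ≥ x}` is nonempty. [folklore] -/
theorem setOf_le_mul_re_nonempty (hsgn : sgn = 1 ∨ sgn = -1) (x : ℝ) : ({z : ℂ | x ≤ sgn * z.re}).Nonempty := by
  refine ⟨((sgn * x : ℝ) : ℂ), ?_⟩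
  show x ≤ sgn * ((sgn * x : ℝ) : ℂ).re
  rw [Complex.ofReal_re]
  rcases hsgn with rfl | rfl <;> simp

/-- The strip `{|im| ≤ u}` is closed. [folklore] -/
theorem isClosed_setOf_abs_im_le (u : ℝ) : IsClosed {z : ℂ | |z.im| ≤ u} :=
  isClosed_le (continuous_abs.comp Complex.continuous_im) continuous_const

end Geometry

namespace Curve

/-! ### The initial segment of a curve up to a closed set: parameters -/

section StopAt

variable {E : Type*} [TopologicalSpace E]

/-- Every point of the initial segment `γ.stopAt F` is a value `γ t` at a parameter
`t ≤ hitParam F`. [folklore] -/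
theorem exists_le_hitParam_of_mem_range_stopAt {F : Set E} {γ : Curve E} {z : E}
    (hz : z ∈ (γ.stopAt F).range) : ∃ t : I, (t : ℝ) ≤ γ.hitParam F ∧ γ t = z := by
  obtain ⟨s, rfl⟩ := hz
  have hT := γ.hitParam_mem_Icc F
  have h0 : 0 ≤ γ.hitParam F * s := mul_nonneg hT.1 s.2.1
  have h1 : γ.hitParam F * s ≤ γ.hitParam F := mul_le_of_le_one_right hT.1 s.2.2
  refine ⟨projIcc 0 1 zero_le_one (γ.hitParam F * s), ?_, ?_⟩
  · rw [projIcc_of_mem _ ⟨h0, h1.trans hT.2⟩]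
    exact h1
  · exact (stopAt_apply F γ s).symm

/-- Conversely every value `γ t` at a parameter `t ≤ hitParam F` is a point of the initial
segment. [folklore] -/
theorem apply_mem_range_stopAt {F : Set E} {γ : Curve E} {t : I} (ht : (t : ℝ) ≤ γ.hitParam F) :
    γ t ∈ (γ.stopAt F).range := by
  have hT := γ.hitParam_mem_Icc F
  rcases eq_or_lt_of_le hT.1 with hT0 | hT0
  · -- `hitParam = 0`, so `t = 0`
    have ht0 : (t : ℝ) = 0 := le_antisymm (ht.trans (le_of_eq hT0.symm)) t.2.1
    refine ⟨0, ?_⟩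
    show γ.stopAt F 0 = γ t
    rw [stopAt_apply]
    congr 1
    apply Subtype.ext
    rw [ht0]
    simp [projIcc]
  · refine ⟨⟨t / γ.hitParam F, div_nonneg t.2.1 hT0.le, div_le_one_of_le₀ ht hT0.le⟩, ?_⟩
    show γ.stopAt F _ = γ t
    rw [stopAt_apply]
    congr 1
    have hval : γ.hitParam F * ((t : ℝ) / γ.hitParam F) = t := mul_div_cancel₀ _ hT0.ne'
    apply Subtype.ext
    simp only [hval]
    rw [projIcc_of_mem _ ⟨t.2.1, t.2.2⟩]

/-- Monotonicity of the hitting parameter: a smaller target set is hit later. [folklore] -/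
theorem hitParam_mono {F F' : Set E} (h : F' ⊆ F) (γ : Curve E) :
    γ.hitParam F ≤ γ.hitParam F' := by
  refine csInf_le_csInf ⟨0, fun _ ht => (γ.hitSet_subset_Icc F ht).1⟩ ⟨1, γ.one_mem_hitSet F'⟩ ?_
  rintro t (⟨ht, hmem⟩ | ht)
  · exact Or.inl ⟨ht, h hmem⟩
  · exact Or.inr ht

/-- The initial segment up to a set `F` is part of the initial segment up to any smaller set
`F' ⊆ F`. [folklore] -/
theorem range_stopAt_mono {F F' : Set E} (h : F' ⊆ F) (γ : Curve E) :
    (γ.stopAt F).range ⊆ (γ.stopAt F').range := by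
  intro z hz
  obtain ⟨t, ht, rfl⟩ := exists_le_hitParam_of_mem_range_stopAt hz
  exact apply_mem_range_stopAt (ht.trans (hitParam_mono h γ))

/-- Two closed sets with the same hitting parameter cut out the same initial segment.
[folklore] -/
theorem stopAt_eq_stopAt_of_hitParam_eq {F F' : Set E} {γ : Curve E}
    (h : γ.hitParam F = γ.hitParam F') : γ.stopAt F = γ.stopAt F' := by
  rw [stopAt_eq_of_coe_eq (t := ⟨γ.hitParam F, γ.hitParam_mem_Icc F⟩) rfl,
    stopAt_eq_of_coe_eq (t := ⟨γ.hitParam F, γ.hitParam_mem_Icc F⟩) (by exact h)]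

/-- The curve meets a closed set `F` iff its trace does. [folklore] -/
theorem exists_apply_mem_iff_range_inter_nonempty {F : Set E} {γ : Curve E} :
    (∃ t, γ t ∈ F) ↔ (γ.range ∩ F).Nonempty :=
  ⟨fun ⟨t, ht⟩ => ⟨γ t, ⟨t, rfl⟩, ht⟩, fun ⟨_, ⟨t, rfl⟩, hz⟩ => ⟨t, hz⟩⟩

end StopAt

/-! ### First hitting of a half-plane `{sgn·re ≥ x}` by a planar curve -/

section HalfPlane

variable {sgn : ℝ}

/-- **The first hitting point of the half-plane `{sgn·re ≥ x}` lies on the line `sgn·re = x`** when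
the curve starts in `{sgn·re < x}` (intermediate value theorem along the curve, and minimality of
the hitting parameter). [folklore] -/
theorem mul_re_apply_hitParam_eq {x : ℝ} {γ : Curve ℂ} (h0 : sgn * γ.source.re < x)
    (h : ∃ t, γ t ∈ {z : ℂ | x ≤ sgn * z.re}) :
    sgn * (γ ⟨γ.hitParam {z : ℂ | x ≤ sgn * z.re}, γ.hitParam_mem_Icc _⟩).re = x := by
  set F : Set ℂ := {z : ℂ | x ≤ sgn * z.re} with hF
  have hFc : IsClosed F := isClosed_setOf_le_mul_re sgn x
  have hmem : γ ⟨γ.hitParam F, γ.hitParam_mem_Icc F⟩ ∈ F := apply_hitParam_mem hFc h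
  refine le_antisymm ?_ hmem
  -- intermediate value theorem for `g s = sgn · re γ(s)` on `[0, T]`
  set T : ℝ := γ.hitParam F with hT
  have hTI := γ.hitParam_mem_Icc F
  set g : ℝ → ℝ := fun s => sgn * (γ (projIcc 0 1 zero_le_one s)).re with hg
  have hgc : Continuous g :=
    continuous_const.mul (Complex.continuous_re.comp (γ.continuous.comp continuous_projIcc))
  have hg0 : g 0 = sgn * γ.source.re := by
    simp only [hg, projIcc_left, source_def]
    rfl
  have hgT : g T = sgn * (γ ⟨γ.hitParam F, γ.hitParam_mem_Icc F⟩).re := by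
    simp only [hg, hT]
    rw [projIcc_of_mem _ hTI]
  by_contra hlt
  push Not at hlt
  -- `x ∈ (g 0, g T)`, so some `s ∈ [0, T]` has `g s = x`; minimality forces `s = T`
  have hx : x ∈ Icc (g 0) (g T) := ⟨by rw [hg0]; exact h0.le, by rw [hgT]; exact hlt.le⟩
  obtain ⟨s, hs, hgs⟩ := intermediate_value_Icc hTI.1 hgc.continuousOn hx
  have hsF : γ (projIcc 0 1 zero_le_one s) ∈ F := by
    show x ≤ sgn * (γ (projIcc 0 1 zero_le_one s)).re
    exact le_of_eq hgs.symm
  have hTs : T ≤ s := by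
    have := hitParam_le (F := F) hsF
    rwa [projIcc_of_mem _ ⟨hs.1, hs.2.trans hTI.2⟩] at this
  have hsT : s = T := le_antisymm hs.2 hTs
  rw [hsT] at hgs
  rw [hgT] at hgs
  exact absurd hgs (ne_of_gt hlt)

/-- **The initial segment up to the first hitting of `{sgn·re ≥ x}` lies in `{sgn·re ≤ x}`** (for a
curve starting in `{sgn·re < x}`): before the hitting parameter the curve is outside the
half-plane, and the hitting point is on the line. [folklore] -/
theorem range_stopAt_halfPlane_subset {x : ℝ} {γ : Curve ℂ} (h0 : sgn * γ.source.re < x) :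
    (γ.stopAt {z : ℂ | x ≤ sgn * z.re}).range ⊆ {z : ℂ | sgn * z.re ≤ x} := by
  intro z hz
  obtain ⟨t, ht, rfl⟩ := exists_le_hitParam_of_mem_range_stopAt hz
  show sgn * (γ t).re ≤ x
  rcases ht.lt_or_eq with hlt | heq
  · exact (not_le.1 (notMem_of_lt_hitParam (F := {z : ℂ | x ≤ sgn * z.re}) hlt)).le
  · by_cases h : ∃ s, γ s ∈ {z : ℂ | x ≤ sgn * z.re}
    · have ht' : t = ⟨γ.hitParam {z : ℂ | x ≤ sgn * z.re}, γ.hitParam_mem_Icc _⟩ := Subtype.ext heq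
      rw [ht']
      exact (mul_re_apply_hitParam_eq h0 h).le
    · push Not at h
      exact (not_le.1 (h t)).le

/-- **"After `τ_{J_k}` the annulus `A(x_{k+1}, u, Cu)` is crossed"** (KS 2017, proof of
Prop. 3.7). Let `γ` start in `{sgn·re < x}` and reach the half-plane `{sgn·re ≥ x + R}`, its initial
segment up to that hitting staying in the strip `{|im| ≤ u}`, with `0 ≤ u < R`. Then the final
segment of `γ` from its first hitting of `{sgn·re ≥ x}` makes a crossing of the annulus
`A(sgn(x + R), u, R)`: it starts on the line `sgn·re = x`, at distance `≥ R` from the centre, and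
passes through the first hitting point of `{sgn·re ≥ x + R}`, which is on the line `sgn·re = x + R`
with `|im| ≤ u`, at distance `≤ u` from the centre; a segment joining the two complementary
components of the annulus contains a crossing (`Curve.HasTraversals.makesCrossing`).
[cite: KemppainenSmirnov2017, §3.3, proof of Prop. 3.7] -/
theorem makesCrossing_startFrom_halfPlane (hsgn : sgn = 1 ∨ sgn = -1) {x R u : ℝ} (hu : 0 ≤ u)
    (huR : u < R) {γ : Curve ℂ} (h0 : sgn * γ.source.re < x)
    (hhit : ∃ t, γ t ∈ {z : ℂ | x + R ≤ sgn * z.re})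
    (hstrip : (γ.stopAt {z : ℂ | x + R ≤ sgn * z.re}).range ⊆ {z : ℂ | |z.im| ≤ u}) :
    (γ.startFrom {z : ℂ | x ≤ sgn * z.re}).MakesCrossing ((sgn * (x + R) : ℝ) : ℂ) u R := by
  set F : Set ℂ := {z : ℂ | x ≤ sgn * z.re} with hF
  set F' : Set ℂ := {z : ℂ | x + R ≤ sgn * z.re} with hF'
  have hR : 0 < R := hu.trans_lt huR
  have hsub : F' ⊆ F := fun z hz => by
    show x ≤ sgn * z.re
    have hz' : x + R ≤ sgn * z.re := hz
    linarith
  have hhitF : ∃ t, γ t ∈ F := by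
    obtain ⟨t, ht⟩ := hhit
    exact ⟨t, hsub ht⟩
  have h0' : sgn * γ.source.re < x + R := by linarith
  -- the two hitting parameters `T ≤ T'` and the two hitting points
  have hTI := γ.hitParam_mem_Icc F
  have hT'I := γ.hitParam_mem_Icc F'
  have hTT' : γ.hitParam F ≤ γ.hitParam F' := hitParam_mono hsub γ
  have hreT : sgn * (γ ⟨γ.hitParam F, hTI⟩).re = x := mul_re_apply_hitParam_eq h0 hhitF
  have hreT' : sgn * (γ ⟨γ.hitParam F', hT'I⟩).re = x + R := mul_re_apply_hitParam_eq h0' hhit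
  have hTlt : γ.hitParam F < γ.hitParam F' := by
    rcases hTT'.lt_or_eq with hlt | heq
    · exact hlt
    · exfalso
      have : (⟨γ.hitParam F, hTI⟩ : I) = ⟨γ.hitParam F', hT'I⟩ := Subtype.ext heq
      rw [this] at hreT
      linarith
  have hT1 : γ.hitParam F < 1 := hTlt.trans_le hT'I.2
  -- the parameter of the future at which it passes through the second hitting point
  have h1T : 0 < 1 - γ.hitParam F := by linarith
  obtain ⟨s', hs'⟩ : ∃ s' : ℝ, s' = (γ.hitParam F' - γ.hitParam F) / (1 - γ.hitParam F) :=
    ⟨_, rfl⟩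
  have hs'0 : 0 ≤ s' := by
    rw [hs']
    exact div_nonneg (by linarith) h1T.le
  have hs'1 : s' ≤ 1 := by
    rw [hs', div_le_one h1T]
    linarith [hT'I.2]
  have hval : γ.hitParam F + (1 - γ.hitParam F) * s' = γ.hitParam F' := by
    rw [hs', mul_div_cancel₀ _ h1T.ne']
    ring
  set δ := γ.startFrom F with hδ
  have hδ0 : δ 0 = γ ⟨γ.hitParam F, hTI⟩ := by
    show γ.startFrom F 0 = _
    rw [startFrom_apply]
    congr 1
    apply Subtype.ext
    simp only [Set.Icc.coe_zero, mul_zero, add_zero]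
    rw [projIcc_of_mem _ hTI]
  have hδs' : δ ⟨s', hs'0, hs'1⟩ = γ ⟨γ.hitParam F', hT'I⟩ := by
    show γ.startFrom F _ = _
    rw [startFrom_apply]
    congr 1
    apply Subtype.ext
    change (projIcc 0 1 zero_le_one (γ.hitParam F + (1 - γ.hitParam F) * s') : ℝ) = γ.hitParam F'
    rw [hval, projIcc_of_mem _ hT'I]
  -- distances to the centre
  have hout : R ≤ dist (δ 0) ((sgn * (x + R) : ℝ) : ℂ) := by
    rw [hδ0]
    exact le_dist_ofReal_of_mul_re_le hsgn hreT.le hR.le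
  have hin : dist (δ ⟨s', hs'0, hs'1⟩) ((sgn * (x + R) : ℝ) : ℂ) ≤ u := by
    rw [hδs']
    refine dist_ofReal_le_of_mul_re_eq hsgn hreT' (hstrip ?_)
    exact apply_mem_range_stopAt le_rfl
  -- one traversal, hence a crossing
  have htrav : δ.HasTraversals 1 ((sgn * (x + R) : ℝ) : ℂ) u R := by
    refine ⟨fun _ => 0, fun _ => ⟨s', hs'0, hs'1⟩, fun _ => ⟨?_, Or.inr ⟨hout, hin⟩⟩,
      fun i j hij => absurd (Fin.lt_def.1 hij) (by omega)⟩
    exact Subtype.coe_le_coe.1 hs'0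
  exact htrav.makesCrossing huR

end HalfPlane

end Curve

/-! ### The events at the level of curve classes -/

namespace CurveClass

variable {sgn : ℝ}

/-- The class meets a set iff its chosen representative does. [folklore] -/
theorem exists_out_apply_mem_iff {F : Set ℂ} {c : CurveClass ℂ} :
    (∃ t : I, c.out t ∈ F) ↔ (c.range ∩ F).Nonempty := by
  rw [Curve.exists_apply_mem_iff_range_inter_nonempty (γ := c.out), range_out]

/-- The initial segment of a class up to the first hitting of `{sgn·re ≥ x}` lies in `{sgn·re ≤ x}`
when the class starts in `{sgn·re < x}`. [folklore] -/
theorem range_stopAt_halfPlane_subset {x : ℝ} {c : CurveClass ℂ} (h0 : sgn * c.source.re < x) :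
    (c.stopAt {z : ℂ | x ≤ sgn * z.re}).range ⊆ {z : ℂ | sgn * z.re ≤ x} := by
  rw [stopAt, range_mk]
  exact Curve.range_stopAt_halfPlane_subset (by rwa [source_out])

/-- Monotonicity of initial segments of a class in the target set. [folklore] -/
theorem range_stopAt_mono {F F' : Set ℂ} (h : F' ⊆ F) (c : CurveClass ℂ) :
    (c.stopAt F).range ⊆ (c.stopAt F').range := by
  rw [stopAt, stopAt, range_mk, range_mk]
  exact Curve.range_stopAt_mono h c.out

/-- **The future of a class from its first hitting of `{sgn·re ≥ x}` crosses the boundary annulus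
`A(sgn(x + R), u, R)`** when the class starts in `{sgn·re < x}`, reaches `{sgn·re ≥ x + R}`, and its
initial segment up to that hitting stays in the strip `{|im| ≤ u}` (`0 ≤ u < R`); class form of
`Curve.makesCrossing_startFrom_halfPlane`. [cite: KemppainenSmirnov2017, §3.3, proof of Prop. 3.7] -/
theorem startFrom_halfPlane_mem_crossingIn (hsgn : sgn = 1 ∨ sgn = -1) {x R u : ℝ} (hu : 0 ≤ u)
    (huR : u < R) {c : CurveClass ℂ} (h0 : sgn * c.source.re < x)
    (hhit : (c.range ∩ {z : ℂ | x + R ≤ sgn * z.re}).Nonempty)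
    (hstrip : (c.stopAt {z : ℂ | x + R ≤ sgn * z.re}).range ⊆ {z : ℂ | |z.im| ≤ u}) :
    c.startFrom {z : ℂ | x ≤ sgn * z.re} ∈ crossingIn ((sgn * (x + R) : ℝ) : ℂ) u R univ := by
  refine ⟨c.out.startFrom {z : ℂ | x ≤ sgn * z.re}, rfl, ?_⟩
  have hhit' : ∃ t, c.out t ∈ {z : ℂ | x + R ≤ sgn * z.re} := exists_out_apply_mem_iff.2 hhit
  have hstrip' : (c.out.stopAt {z : ℂ | x + R ≤ sgn * z.re}).range ⊆ {z : ℂ | |z.im| ≤ u} := by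
    rwa [stopAt, range_mk] at hstrip
  exact Curve.makesCrossing_startFrom_halfPlane hsgn hu huR (by rwa [source_out]) hhit' hstrip'

end CurveClass

/-! ### The probabilistic bound (KS Prop. 3.7) -/

section Measure

variable {sgn : ℝ}

/-- The set of pasts used at the `k`-th step: classes starting in `{sgn·re < x₀}`, ending in the
half-plane `{sgn·re ≥ x}` and staying in `{|im| ≤ u} ∩ {sgn·re ≤ x}`, is measurable. [folklore] -/
theorem measurableSet_rectanglePasts (sgn x₀ x u : ℝ) :
    MeasurableSet {p : CurveClass ℂ | sgn * p.source.re < x₀ ∧ p.target ∈ {z : ℂ | x ≤ sgn * z.re} ∧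
      p.range ⊆ {z : ℂ | |z.im| ≤ u} ∩ {z : ℂ | sgn * z.re ≤ x}} := by
  have h1 : IsOpen {p : CurveClass ℂ | sgn * p.source.re < x₀} :=
    isOpen_lt (continuous_const.mul (Complex.continuous_re.comp CurveClass.continuous_source))
      continuous_const
  have h2 : IsClosed {p : CurveClass ℂ | p.target ∈ {z : ℂ | x ≤ sgn * z.re}} :=
    (isClosed_setOf_le_mul_re sgn x).preimage CurveClass.continuous_target
  have h3 : MeasurableSet (CurveClass.rangeSubset ({z : ℂ | |z.im| ≤ u} ∩ {z : ℂ | sgn * z.re ≤ x})) :=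
    CurveClass.measurableSet_rangeSubset ((isClosed_setOf_abs_im_le u).inter
      (isClosed_le (continuous_const.mul Complex.continuous_re) continuous_const))
  exact h1.measurableSet.inter (h2.measurableSet.inter h3)

/-- **Kemppainen–Smirnov's rectangle-exit bound, one side** (Ann. Probab. 45 (2017), Prop. 3.7
and its proof). Let `μ` be a measure on curve classes satisfying the boundary-annulus instances
of Condition G2 in `ℍ` at height `u > 0` with ratio `C > 1`: for every nonempty closed `F`, every
real centre `z₀` and every measurable set `S` of pasts whose traces avoid the open disc
`B(z₀, Cu)`, `μ({stopAt F ∈ S} ∩ {startFrom F crosses A(z₀, u, Cu)}) ≤ ½ μ{stopAt F ∈ S}`. Then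
for every threshold `x₀`, sign `sgn = ±1` and `n : ℕ`, the classes which start in `{sgn·re < x₀}`,
reach the half-plane `{sgn·re ≥ x₀ + n·Cu}`, and whose initial segment up to that hitting time
stays in the strip `{|im| ≤ u}`, have measure at most `2^{-n} μ(univ)`: with the lines
`x_k = x₀ + k·Cu`, the `k+1`-st event is contained in the `k`-th one intersected with "the future
from the first hitting of `{sgn·re ≥ x_k}` crosses `A(sgn x_{k+1}, u, Cu)`", whose past avoids
`B(sgn x_{k+1}, Cu)`, so each step costs a factor `½`. [cite: KemppainenSmirnov2017, §3.3, Prop. 3.7] -/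
theorem measure_reach_halfPlane_le (μ : Measure (CurveClass ℂ)) {C u : ℝ} (hsgn : sgn = 1 ∨ sgn = -1)
    (hC : 1 < C) (hu : 0 < u)
    (hG : ∀ F : Set ℂ, IsClosed F → F.Nonempty → ∀ (z₀ : ℝ) (S : Set (CurveClass ℂ)),
      MeasurableSet S → S ⊆ {p | Disjoint p.range (ball ((z₀ : ℝ) : ℂ) (C * u))} →
      μ (CurveClass.stopAt F ⁻¹' S ∩
          {c | c.startFrom F ∈ CurveClass.crossingIn ((z₀ : ℝ) : ℂ) u (C * u) univ}) ≤
        2⁻¹ * μ (CurveClass.stopAt F ⁻¹' S))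
    (x₀ : ℝ) (n : ℕ) :
    μ {c | sgn * c.source.re < x₀ ∧ (c.range ∩ {z : ℂ | x₀ + n * (C * u) ≤ sgn * z.re}).Nonempty ∧
        (c.stopAt {z : ℂ | x₀ + n * (C * u) ≤ sgn * z.re}).range ⊆ {z : ℂ | |z.im| ≤ u}} ≤
      2⁻¹ ^ n * μ univ := by
  have hCu : 0 < C * u := mul_pos (zero_lt_one.trans hC) hu
  have huCu : u < C * u := lt_mul_left hu hC
  -- the lines `x k` and the events `E k`
  set x : ℕ → ℝ := fun k => x₀ + k * (C * u) with hx
  have hxsucc : ∀ k, x (k + 1) = x k + C * u := fun k => by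
    simp only [hx, Nat.cast_succ]
    ring
  have hx0k : ∀ k : ℕ, x₀ ≤ x k := fun k => by
    simp only [hx]
    nlinarith [hCu.le, (Nat.cast_nonneg k : (0 : ℝ) ≤ k)]
  set H : ℕ → Set ℂ := fun k => {z : ℂ | x k ≤ sgn * z.re} with hH
  set E : ℕ → Set (CurveClass ℂ) := fun k =>
    {c | sgn * c.source.re < x₀ ∧ (c.range ∩ H k).Nonempty ∧
      (c.stopAt (H k)).range ⊆ {z : ℂ | |z.im| ≤ u}} with hE
  -- the one-step bound
  have hstep : ∀ k, μ (E (k + 1)) ≤ 2⁻¹ * μ (E k) := by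
    intro k
    -- the set of pasts
    set S : Set (CurveClass ℂ) := {p | sgn * p.source.re < x₀ ∧ p.target ∈ H k ∧
      p.range ⊆ {z : ℂ | |z.im| ≤ u} ∩ {z : ℂ | sgn * z.re ≤ x k}} with hS
    have hSm : MeasurableSet S := measurableSet_rectanglePasts sgn x₀ (x k) u
    have hSdisj : S ⊆ {p | Disjoint p.range (ball (((sgn * (x k + C * u)) : ℝ) : ℂ) (C * u))} := by
      rintro p ⟨-, -, hp⟩
      refine Set.disjoint_left.2 fun z hz hzb => ?_
      have hle : C * u ≤ dist z (((sgn * (x k + C * u)) : ℝ) : ℂ) :=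
        le_dist_ofReal_of_mul_re_le hsgn (hp hz).2 hCu.le
      exact absurd (mem_ball.1 hzb) (not_lt.2 hle)
    -- `{stopAt (H k) ∈ S} = E k`
    have hpre : CurveClass.stopAt (H k) ⁻¹' S = E k := by
      ext c
      simp only [mem_preimage, hS, hE, mem_setOf_eq]
      constructor
      · rintro ⟨h0, htgt, hrange⟩
        rw [CurveClass.source_stopAt] at h0
        refine ⟨h0, ?_, fun z hz => (hrange hz).1⟩
        -- the target of the stopped class lies on the trace and in `H k`
        refine ⟨(c.stopAt (H k)).target, ?_, htgt⟩
        exact CurveClass.range_stopAt_subset _ c (CurveClass.target_mem_range _)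
      · rintro ⟨h0, hhit, hrange⟩
        refine ⟨by rwa [CurveClass.source_stopAt], ?_, fun z hz => ⟨hrange hz, ?_⟩⟩
        · -- the stopped class ends at the hitting point, which is in `H k`
          have hhit' : ∃ t, c.out t ∈ H k := CurveClass.exists_out_apply_mem_iff.2 hhit
          show (CurveClass.mk (c.out.stopAt (H k))).target ∈ H k
          rw [CurveClass.target_mk, Curve.target_stopAt]
          exact Curve.apply_hitParam_mem (isClosed_setOf_le_mul_re sgn (x k)) hhit'
        · exact CurveClass.range_stopAt_halfPlane_subset (h0.trans_le (hx0k k)) hz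
    -- `E (k+1) ⊆ {stopAt (H k) ∈ S} ∩ {future crosses}`
    have hsub : E (k + 1) ⊆ CurveClass.stopAt (H k) ⁻¹' S ∩
        {c | c.startFrom (H k) ∈
          CurveClass.crossingIn (((sgn * (x k + C * u)) : ℝ) : ℂ) u (C * u) univ} := by
      intro c hc
      obtain ⟨h0, hhit, hrange⟩ := hc
      have hHsub : H (k + 1) ⊆ H k := fun z hz => by
        show x k ≤ sgn * z.re
        have hz' : x (k + 1) ≤ sgn * z.re := hz
        rw [hxsucc] at hz'
        linarith
      refine ⟨?_, ?_⟩
      · rw [hpre]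
        exact ⟨h0, hhit.mono (inter_subset_inter_right _ hHsub),
          (CurveClass.range_stopAt_mono hHsub c).trans hrange⟩
      · have hhit' : (c.range ∩ {z : ℂ | x k + C * u ≤ sgn * z.re}).Nonempty := by
          rw [← hxsucc]; exact hhit
        have hrange' : (c.stopAt {z : ℂ | x k + C * u ≤ sgn * z.re}).range ⊆
            {z : ℂ | |z.im| ≤ u} := by
          rw [← hxsucc]; exact hrange
        exact CurveClass.startFrom_halfPlane_mem_crossingIn hsgn hu.le huCu
          (h0.trans_le (hx0k k)) hhit' hrange'
    calc μ (E (k + 1))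
        ≤ μ (CurveClass.stopAt (H k) ⁻¹' S ∩ {c | c.startFrom (H k) ∈
            CurveClass.crossingIn (((sgn * (x k + C * u)) : ℝ) : ℂ) u (C * u) univ}) :=
          measure_mono hsub
      _ ≤ 2⁻¹ * μ (CurveClass.stopAt (H k) ⁻¹' S) :=
          hG (H k) (isClosed_setOf_le_mul_re sgn (x k)) (setOf_le_mul_re_nonempty hsgn (x k)) _ S hSm hSdisj
      _ = 2⁻¹ * μ (E k) := by rw [hpre]
  -- induction
  have hind : ∀ k, μ (E k) ≤ 2⁻¹ ^ k * μ univ := by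
    intro k
    induction k with
    | zero => simpa using measure_mono (subset_univ (E 0))
    | succ k ih =>
      calc μ (E (k + 1)) ≤ 2⁻¹ * μ (E k) := hstep k
        _ ≤ 2⁻¹ * (2⁻¹ ^ k * μ univ) := by gcongr
        _ = 2⁻¹ ^ (k + 1) * μ univ := by rw [pow_succ, ← mul_assoc, mul_comm (2⁻¹ ^ k)]
  exact hind n

/-- **Kemppainen–Smirnov's rectangle-exit bound, both sides** (Ann. Probab. 45 (2017),
Prop. 3.7: "`P(Re[(Φγ)(τ_{R_{L,u}})] = ±L) ≤ K e^{-cL/u}`"; "by symmetry, it is enough to consider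
the event that `Φγ` exits the rectangle from the right-hand side"). Under the boundary-annulus
crossing bound of `measure_reach_halfPlane_le`, the classes which start in `{|re| < x₀}`, reach
`{|re| ≥ x₀ + n·Cu}`, and whose initial segment up to that hitting time stays in the strip
`{|im| ≤ u}`, have measure at most `2 · 2^{-n} μ(univ)`: according to the side of the first
hitting point, such a class belongs to the one-sided event for `sgn = 1` or for `sgn = -1` (the
first hitting of `{|re| ≥ L}` and of the half-plane on that side happen at the same parameter,
so the two initial segments coincide). [cite: KemppainenSmirnov2017, §3.3, Prop. 3.7] -/
theorem measure_reach_abs_re_le (μ : Measure (CurveClass ℂ)) {C u : ℝ} (hC : 1 < C) (hu : 0 < u)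
    (hG : ∀ F : Set ℂ, IsClosed F → F.Nonempty → ∀ (z₀ : ℝ) (S : Set (CurveClass ℂ)),
      MeasurableSet S → S ⊆ {p | Disjoint p.range (ball ((z₀ : ℝ) : ℂ) (C * u))} →
      μ (CurveClass.stopAt F ⁻¹' S ∩
          {c | c.startFrom F ∈ CurveClass.crossingIn ((z₀ : ℝ) : ℂ) u (C * u) univ}) ≤
        2⁻¹ * μ (CurveClass.stopAt F ⁻¹' S))
    (x₀ : ℝ) (n : ℕ) :
    μ {c | |c.source.re| < x₀ ∧ (c.range ∩ {z : ℂ | x₀ + n * (C * u) ≤ |z.re|}).Nonempty ∧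
        (c.stopAt {z : ℂ | x₀ + n * (C * u) ≤ |z.re|}).range ⊆ {z : ℂ | |z.im| ≤ u}} ≤
      2 * 2⁻¹ ^ n * μ univ := by
  set L : ℝ := x₀ + n * (C * u) with hL
  set F : Set ℂ := {z : ℂ | L ≤ |z.re|} with hF
  have hFc : IsClosed F := isClosed_le continuous_const (continuous_abs.comp Complex.continuous_re)
  -- the one-sided events
  set Ev : ℝ → Set (CurveClass ℂ) := fun sgn =>
    {c | sgn * c.source.re < x₀ ∧ (c.range ∩ {z : ℂ | x₀ + n * (C * u) ≤ sgn * z.re}).Nonempty ∧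
      (c.stopAt {z : ℂ | x₀ + n * (C * u) ≤ sgn * z.re}).range ⊆ {z : ℂ | |z.im| ≤ u}} with hEv
  -- reduction of a class hitting `F` first on the side `sgn` to the one-sided event
  have key : ∀ (sgn : ℝ) (c : CurveClass ℂ), sgn * c.source.re < x₀ →
      (c.stopAt F).range ⊆ {z : ℂ | |z.im| ≤ u} → (∃ t, c.out t ∈ F) →
      L ≤ sgn * (c.out ⟨c.out.hitParam F, c.out.hitParam_mem_Icc F⟩).re →
      {z : ℂ | L ≤ sgn * z.re} ⊆ F → c ∈ Ev sgn := by
    intro sgn c h0 hstrip hhit hside hsub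
    set H : Set ℂ := {z : ℂ | L ≤ sgn * z.re} with hH
    -- the two hitting parameters agree
    have hle : c.out.hitParam F ≤ c.out.hitParam H := Curve.hitParam_mono hsub c.out
    have hge : c.out.hitParam H ≤ c.out.hitParam F :=
      Curve.hitParam_le (F := H) (t := ⟨c.out.hitParam F, c.out.hitParam_mem_Icc F⟩) hside
    have heq : c.out.stopAt H = c.out.stopAt F :=
      Curve.stopAt_eq_stopAt_of_hitParam_eq (le_antisymm hge hle)
    have heq' : c.stopAt H = c.stopAt F := by
      show CurveClass.mk (c.out.stopAt H) = CurveClass.mk (c.out.stopAt F)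
      rw [heq]
    refine ⟨h0, ⟨c.out ⟨c.out.hitParam F, c.out.hitParam_mem_Icc F⟩, ?_, hside⟩, ?_⟩
    · rw [← CurveClass.range_out]
      exact ⟨_, rfl⟩
    · show (c.stopAt H).range ⊆ _
      rw [heq']
      exact hstrip
  -- the two-sided event is covered by the two one-sided events
  have hcover : {c : CurveClass ℂ | |c.source.re| < x₀ ∧ (c.range ∩ F).Nonempty ∧
      (c.stopAt F).range ⊆ {z : ℂ | |z.im| ≤ u}} ⊆ Ev 1 ∪ Ev (-1) := by
    rintro c ⟨h0, hhit, hstrip⟩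
    have hhit' : ∃ t, c.out t ∈ F := CurveClass.exists_out_apply_mem_iff.2 hhit
    have hp : c.out ⟨c.out.hitParam F, c.out.hitParam_mem_Icc F⟩ ∈ F :=
      Curve.apply_hitParam_mem hFc hhit'
    have hpL : L ≤ |(c.out ⟨c.out.hitParam F, c.out.hitParam_mem_Icc F⟩).re| := hp
    have h0' := abs_lt.1 h0
    rcases le_or_gt 0 (c.out ⟨c.out.hitParam F, c.out.hitParam_mem_Icc F⟩).re with hre | hre
    · left
      refine key 1 c (by linarith) hstrip hhit' ?_ fun z hz => ?_
      · rw [abs_of_nonneg hre] at hpL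
        linarith
      · show L ≤ |z.re|
        have hz' : L ≤ 1 * z.re := hz
        rw [one_mul] at hz'
        exact hz'.trans (le_abs_self _)
    · right
      refine key (-1) c (by linarith) hstrip hhit' ?_ fun z hz => ?_
      · rw [abs_of_neg hre] at hpL
        linarith
      · show L ≤ |z.re|
        have hz' : L ≤ -1 * z.re := hz
        rw [neg_one_mul] at hz'
        exact hz'.trans (neg_le_abs _)
  calc μ {c | |c.source.re| < x₀ ∧ (c.range ∩ F).Nonempty ∧
          (c.stopAt F).range ⊆ {z : ℂ | |z.im| ≤ u}}
      ≤ μ (Ev 1 ∪ Ev (-1)) := measure_mono hcover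
    _ ≤ μ (Ev 1) + μ (Ev (-1)) := measure_union_le _ _
    _ ≤ 2⁻¹ ^ n * μ univ + 2⁻¹ ^ n * μ univ :=
        add_le_add (measure_reach_halfPlane_le μ (Or.inl rfl) hC hu hG x₀ n)
          (measure_reach_halfPlane_le μ (Or.inr rfl) hC hu hG x₀ n)
    _ = 2 * 2⁻¹ ^ n * μ univ := by rw [← two_mul, mul_assoc]

end Measure

end Literature.Probability.RandomPlanarGeometry
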